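import Summits.ResolutionOfSingularities.ResolutionOfSingularities.Theorems.FactorCutKernels2
import HarnessLib

/-!
# FactorCutCells — decomp-res node «FactorCut» (lens-4 g33, critic row 191 CLEARED +1), tree file 3/5 of the node

Content VERBATIM from the decomp-res lens-4 g33 node `HOME/decomp-res-lens-4/g33/FactorCut.lean` (pin dd0f861c; NEW
part §99–§104 only; the node's carry of g32 rev 2 dropped in favour of `import …TauChainCutCells2`); HOME =
run/shared/lean/pub/decomp-res; critic row 191 CLEARED +1; landing orders INBOX :1049/:1051 — provenance, critic
text and the lens header in full in the first file of the node, `FactorCutKernels`.  Namespace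
`…Theorems.HugValuationCut`; `--supports stmt-ResolutionOfSingularities-28338`.

## This file

§103 (THE CUT «FactorCut», `section FactorCells` MINUS the `h71` corollaries, which live in the Theses-cone file
`MaxContactCutFactorCut`): the g32 MIXED residual = CELL A (latent factor ∧ threefold · DECIDED · EMPTY in kernel,
`NoWildLatentFactorThreefoldMixedTowers`) ∧ CELL B (latent factor ∧ ¬threefold · DECIDED · EMPTY mod 31571 by name,
`NoWildLatentFactorNonThreefoldMixedTowers`) ∧ CELL C (occult ∧ divisorial · THE LOCATED RESIDUAL · UNDECIDED ·
IDEA-NEEDED, `NoWildOccultDivisorialMixedTowers`) ∧ CELL D (occult ∧ non-divisorial · UNDECIDED · ATTACKABLE,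
`NoWildOccultNonDivisorialMixedTowers`) — exact by `noTowerWild_split`, hypothesis-free re-location
`noWildMixedWallFreeFreshJumpShallowCompanionKangarooTowers_iff_g33`; plus the writer-added one-name residual
**`NoWildOccultMixedTowers`** ≔ C ∧ D (the route aside's HOME is this file, cone-free; rider INBOX :1051); §104
(ENTRANCE CERTIFICATES, `section OccultEntrances`): kernel-checked chart identities of the occult profiles (O1)…
quoted in the cells' docstrings.  (This first part carries: `LatentFactorTower`, `DivisorialTower`, `MixedResidual`,
`wildMixedWallFreeFreshJumpShallow_iff_mixedResidual`, `MixedResidual.singularClass`,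
`WildLatentFactorThreefoldMixedWallFreeFreshJumpShallowCompanionKangarooTowersTerminate`,
`WildLatentFactorNonThreefoldMixedWallFreeFreshJumpShallowCompanionKangarooTowersTerminate`,
`WildOccultDivisorialMixedWallFreeFreshJumpShallowCompanionKangarooTowersTerminate`,
`WildOccultNonDivisorialMixedWallFreeFreshJumpShallowCompanionKangarooTowersTerminate`,
`noTowerWild_latentFactor_threefold`, `noTowerWild_latentFactor_of_contact`, `wildLatentFactorThreefoldMixed_holds`,
`wildLatentFactorNonThreefoldMixed_of_contact`, `wildMixedWallFreeFreshJumpShallow_split_cells`,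
`wildMixedWallFreeFreshJumpShallow_iff_g33`, `wildMixedWallFreeFreshJumpShallow_iff_g33_of_contact`,
`occult_letters`, `FactorAt.dvd_of_occult`, `NoWildLatentFactorThreefoldMixedTowers`,
`NoWildLatentFactorNonThreefoldMixedTowers`, `NoWildOccultDivisorialMixedTowers`,
`NoWildOccultNonDivisorialMixedTowers`, `NoWildOccultMixedTowers`, `noWildLatentFactorThreefoldMixedTowers_holds`,
`noWildMixedWallFreeFreshJumpShallowCompanionKangarooTowers_iff_cells`,
`noWildMixedWallFreeFreshJumpShallowCompanionKangarooTowers_iff_g33`, `noWildOccultDivisorialMixedTowers_of_g32`,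
`noWildOccultNonDivisorialMixedTowers_of_g32`, `noWildOccultMixedTowers_of_aside`,
`noTowerWild_contactFreeOffLocus_latentFactor`.)

[WRITER NOTE (decomp-res writer g12): file split only (tree files ≤ 400 lines); namespace, sections, section
variables / universes / opens and every declaration exactly as in the lens (the carry block and the node's global
dupNamespace-linter line are dropped — the library sets the latter; the two namespace-level `open
…AbsoluteContactClasses` / `open …Hironaka2005 (…)` lines of the new part are replayed in every file; the `open
…Theses` line and the lens's cone imports `MaxContactCutSatelliteCut` / `MaxContactCutWallCutCells` /
`MaxContactCutSurfacePort` live only in the Theses-cone file `MaxContactCutFactorCut`).]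

(Sources: Hironaka1964 Ch. III; Giraud1975 (Giraud's lemma); Kollar2007 3.58–3.60; CossartJannsenSaito2020 Thm.
6.40, Def. 6.38–6.39, Ch. 8; Hauser2010Kangaroo; HauserPerlega2019 §2; CossartPiltant2008 §2; CossartPiltant2019;
Hironaka2005 (three key theorems); EGAIV4 §16; Matsumura1987 §28; StacksProject 0804 / 0BIQ / 031I.)
-/

noncomputable section

open CategoryTheory AlgebraicGeometry IsLocalRing TopologicalSpace
open Literature.AlgebraicGeometry.Resolution
open Summit.ResolutionOfSingularities.ResolutionOfSingularities.Theorems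
open WeakOrderReduction ForcedTowerClasses DivergentTowerClasses MonomialTowerClasses
open HugDimensionClasses HugDimensionKernels SurfaceShadowClasses SurfaceShadowKernels
open NearPointCut (SingularClass)
open Scheme.IdealSheafData (vanishingIdeal)
open scoped BigOperators

namespace Summit.ResolutionOfSingularities.ResolutionOfSingularities.Theorems.HugValuationCut

open Summit.ResolutionOfSingularities.ResolutionOfSingularities.Theorems.AbsoluteContactClasses
  (IsAbsContactAt SepResidueAt AbsInv absInv_point sepResidueAt_of_perfectField)
open Literature.AlgebraicGeometry.Resolution.Hironaka2005 (le_idealOrder_of_mul_le le_idealOrder_of_mul_le')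

section FactorCells

variable {k : Type} [Field k]

/-! ## §103 (g33 · THE CUT «FactorCut») the mixed residual = CELL A (latent factor ∧ threefold · DECIDED · EMPTY in
kernel) ∧ CELL B
(latent factor ∧ ¬threefold · DECIDED · EMPTY mod 31571 by name) ∧ CELL C (occult ∧ divisorial · THE LOCATED
RESIDUAL · UNDECIDED ·
IDEA-NEEDED) ∧ CELL D (occult ∧ non-divisorial · UNDECIDED · ATTACKABLE) — exact by `noTowerWild_split`;
re-locations BY NAME down the
aside chain.

THE LEVER (lane (NP-b) of row 186, «(MX) 𝓘 = H·K with a forcing proof in kernel»): cut the mixed residual by the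
STALK FACTORIZATIONS
of the marked ideal at the marked points.  The FORCING LAW (§100) makes every factorization persist with its
weights; the TRANSPORT ENGINE
(§102) turns an absolute contact element of ANY factor AT ITS OWN WEIGHT into a regular hypersurface germ hugged by
the tower.  So a
factor is either LATENT (carries absolute contact of its own weight `a < n` — invisible to the marked weight `n`,
which only sees
`Diff^{≤ n-1}`; e.g. every factor of weight 1, every factor of weight prime to `p` over a perfect field) — then the
tower is CONTACT, and in
ring dimension 3 it hugs a REGULAR SURFACE germ, contradicting the singular class IN KERNEL — or OCCULT.  The
located residual is the
OCCULT MIXED tower: every factor of every stalk factorization at every stage is absolutely contact-free at its own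
weight; over a perfect
field all weights of all factors are multiples of `p` (`FactorAt.dvd_of_occult`), in particular `n ≥ 2p` as soon as a proper
factorization exists. -/

/-- **LETTER «LATENT FACTOR»** (tower-intrinsic): at some stage the marked stalk factors `𝓘_{x_m} = H·K` with a
factor `H` of positive
weight `a` carrying an ABSOLUTE CONTACT ELEMENT OF ITS OWN WEIGHT at `x_m` (`∃ u ∈ Diff^{a-1}_ℤ(H_{x_m})`, `u ∈ 𝔪 ∖ 𝔪²`). -/
def LatentFactorTower (T : ForcedTower) : Prop :=
  ∃ (m a b : ℕ) (H K : (T.St m).IdealSheafData), FactorAt T m a b H K ∧ 1 ≤ a ∧ IsAbsContactAt H a (T.pt m)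

/-- **LETTER «DIVISORIAL»** (tower-intrinsic): at some stage the marked stalk has a PRINCIPAL factor of positive weight
(`𝓘_{x_m} = (h)·K_{x_m}`, `ord h = a ≥ 1`): the zero locus has a divisorial component through the marked point. -/
def DivisorialTower (T : ForcedTower) : Prop :=
  ∃ (m a b : ℕ) (H K : (T.St m).IdealSheafData), FactorAt T m a b H K ∧ 1 ≤ a ∧ (stalkIdeal H (T.pt m)).IsPrincipal

/-- the binder of the g32 mixed residual `WildMixedWallFreeFreshJumpShallowCompanionKangarooTowersTerminate n`,
NAMED (verbatim its
letters: singular class, marked shadow, `p`-power forms, jump-recurrent, companion-recurrent, shallow, fresh-jumping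
at prime weight,
wall-free at weight 2, non-surface, non-steep, not a principal threefold, not a curve-like threefold). -/
def MixedResidual (n : ℕ) (T : ForcedTower) : Prop :=
  ((((((((((SingularClass T ∧ Nonempty (MarkedShadow T n)) ∧ PPowerTower n T) ∧ ¬ EventuallyJumpFree n T) ∧
    ¬ EventuallyCompanionJumpFree n T) ∧ ¬ DeepTower n T) ∧ ¬ (n.Prime ∧ OldComponentJumpTower n T)) ∧
    ¬ (n = 2 ∧ WalledTower T)) ∧ ¬ SurfaceColumn n T) ∧ ¬ SteepThreefold n T) ∧ ¬ (PrincipalRoot T ∧ ThreefoldTower T)) ∧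
    ¬ (ThreefoldTower T ∧ CurveLikeTower T)

/-- the g32 residual IS `NoTowerWild n (MixedResidual n)` (definitional). [folklore] -/
theorem wildMixedWallFreeFreshJumpShallow_iff_mixedResidual (n : ℕ) :
    WildMixedWallFreeFreshJumpShallowCompanionKangarooTowersTerminate n ↔ NoTowerWild n fun T => MixedResidual n T :=
  Iff.rfl

/-- a tower of the mixed residual is of the singular class. [folklore] -/
theorem MixedResidual.singularClass {n : ℕ} {T : ForcedTower} (h : MixedResidual n T) : SingularClass T :=
  h.1.1.1.1.1.1.1.1.1.1.1

/-- **CELL A (mixed residual ∧ LATENT FACTOR ∧ THREEFOLD)** — DECIDED: EMPTY IN KERNEL (every `p`, every field,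
every `n`): the latent
factor's contact element, transported along the factor chain (§102), is a REGULAR SURFACE germ (ring dimension 3)
hugged by the tower —
contradicting the singular class (`¬ RegularSurfaceHugging`).  ENTRANCES = ALL ELEVEN mixed seeds of the census (§F of
`census/T-surface.md`, `T-surface-mixed.json`: every one has a LINEAR divisorial factor, `a = 1`, e.g. FOFF2:8
`y·(y² + x³u, xu²)` over
`𝔽₃`), g32's (M1) `x·(x, y³, u³)` over `𝔽₂` (linear factor `x`), and the tame mixed profile `(y² + x³u)·(y, u²)`
over `𝔽₃` (`a = 2`
prime to `3`, perfect field: latent by `FactorAt.isAbsContactAt_of_tame_perfect`) — ALL VACATED here. -/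
def WildLatentFactorThreefoldMixedWallFreeFreshJumpShallowCompanionKangarooTowersTerminate (n : ℕ) : Prop :=
  NoTowerWild n fun T => MixedResidual n T ∧ (LatentFactorTower T ∧ ThreefoldTower T)

/-- **CELL B (mixed residual ∧ ¬(latent ∧ threefold) ∧ LATENT FACTOR)** — i.e. a latent factor at a tower with a
marked point of ring
dimension 4 — DECIDED: EMPTY MOD 31571 BY NAME (`MaxContactCut.NoContactHuggingTowers`): the transported contact
germ makes the tower
CONTACT (`FactorAt.contactHugging_of_absContact`).  ENTRANCE: (R′2)-type fourfold profiles with a linear factor, e.g.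
`w·(z² + x³ + y³ + w³, x²)` over `𝔽₂` in `𝔸⁴`. -/
def WildLatentFactorNonThreefoldMixedWallFreeFreshJumpShallowCompanionKangarooTowersTerminate (n : ℕ) : Prop :=
  NoTowerWild n fun T => (MixedResidual n T ∧ ¬ (LatentFactorTower T ∧ ThreefoldTower T)) ∧ LatentFactorTower T

/-- **CELL C (mixed residual ∧ OCCULT ∧ DIVISORIAL) · THE LOCATED RESIDUAL after g33 — «THE OCCULT DIVISORIAL
TOWER»** — UNDECIDED ·
IDEA-NEEDED.  Letters (sharp, `occult_letters`): all of g32's, AND no factor of any stalk factorization at any stage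
carries absolute
contact of its own weight (in particular NO factor of weight 1 anywhere, and over a perfect field every factor
weight is a multiple of
`p`), AND some stage has a PRINCIPAL factor `(h)` of weight `a ≥ 2` (`p ∣ a`; `b = n - a` may be `0`: this cell also
holds the occult
towers that are principal at some stage, in ring dimension 4 or after the root) — whose strict transforms are then
HUGGED by every
later marked point with `ord = a` forced (§101): an EQUIMULTIPLE SINGULAR hypersurface companion `V(h)` of
multiplicity `a` riding the
tower inside the top locus of its own weight.  CERTIFIED INHABITANT of the letters at one stage + its near point (§104
`occult_divisorial_entrance_chart`): `p = 2`, `n = 4`, rd 3, `𝓘 = H·K`, `H = y² + x⁵ + x³u² = y² + x³(x+u)²`, `K =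
(y², u³, yu²)` over
`𝔽₂` at the origin of `𝔸³`: `ord H = ord K = 2`, `in₄ 𝓘 = Y⁴` (a `2`-power form, plane cone `Y`, `τ = 1`),
NON-PRINCIPAL (`K` is not),
`V(𝓘) = V(H) ∪ {y = u = 0}` (a surface and a curve: neither hypersurface nor curve-like), `Top(H,2) = {x = y = 0} ∪
{y = 0, x = u}`,
`Top(K,2) = {y = u = 0}`, so `Top(𝓘,4) = {0}` ISOLATED; OCCULT: `Diff^{≤1}(H) = (H, x²(x+u)²) ⊆ 𝔪²`, `Diff^{≤1}(K) =
(y², u², yu², u³)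
⊆ 𝔪²`, `Diff^{≤3}(𝓘) ⊆ 𝔪²` (Leibniz; `y⁴` is a `4`-th power, `C(4,k)` even), `H` irreducible (`x³(x+u)²` is not a
square); `x`-chart:
`𝓘₁ = H₁·K₁`, `H₁ = y² + x³(1+u)²`, `K₁ = (y², xu³, xyu²)` at the origin — the UNIQUE near point — again occult
mixed with weights
`(2,2)`, `Top(H₁,2) ∩ Top(K₁,2) = {x = y = 0} ∩ {y = u = 0} = {0}`.  No census bed lies here (every census seed has
a linear factor). -/
def WildOccultDivisorialMixedWallFreeFreshJumpShallowCompanionKangarooTowersTerminate (n : ℕ) : Prop :=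
  NoTowerWild n fun T => ((MixedResidual n T ∧ ¬ (LatentFactorTower T ∧ ThreefoldTower T)) ∧ ¬ LatentFactorTower T) ∧
    DivisorialTower T

/-- **CELL D (mixed residual ∧ OCCULT ∧ NON-DIVISORIAL) — «THE OCCULT NON-DIVISORIAL TOWER»** — UNDECIDED · ATTACKABLE: no stalk
factorization at any stage has a principal factor of positive weight — the marked stalks have height `≥ 2` at EVERY
stage (no divisorial
component through any marked point; in ring dimension 3: curve-like AT the marked points), while (g32 letter) some stage is not
curve-like GLOBALLY (a far divisorial component) or some marked point has ring dimension 4.  In ring dimension 3 this is Law C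
(`noTower_threefold_curveLike`) up to RESTRICTION of the tower to a neighbourhood of the root (NEXT-g34 (R):
divisorial components of
`V(𝓘_{i+1})` are strict transforms of those of `V(𝓘_i)` — the exceptional divisor is never one, `ord_E π^*𝓘_i = n` —
so a tower curve-like at
its marked points is curve-like on the preimages of a root neighbourhood).  CERTIFIED INHABITANT of the letters (§104
`occult_nonDivisorial_entrance_chart`): `p = n = 3`, rd 3, `𝓘 = (x - 1)·(y³ + x³u², u⁴, yu³)` over `𝔽₃`, marked at
the origin where
`𝓘_0 = (y³ + x³u², u⁴, yu³)` (height 2, `in₃ = Y³`, non-principal, occult: `Diff^{≤2} ⊆ 𝔪²` in characteristic 3,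
`Top = {0}` near `0`),
not curve-like because of the far plane `x = 1`; `x`-chart near point `(y³ + x²u², xu⁴, xyu³)`, again of height 2. -/
def WildOccultNonDivisorialMixedWallFreeFreshJumpShallowCompanionKangarooTowersTerminate (n : ℕ) : Prop :=
  NoTowerWild n fun T => ((MixedResidual n T ∧ ¬ (LatentFactorTower T ∧ ThreefoldTower T)) ∧ ¬ LatentFactorTower T) ∧
    ¬ DivisorialTower T

/-- **DECIDED (KERNEL; every class `P` inside the singular class, every `n`, every `p`, every field): THE
LATENT-FACTOR-THREEFOLD CUT IS
EMPTY.** [folklore] -/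
theorem noTowerWild_latentFactor_threefold {n : ℕ} (P : ForcedTower → Prop) (hP : ∀ T, P T → SingularClass T) :
    NoTowerWild n fun T => P T ∧ (LatentFactorTower T ∧ ThreefoldTower T) := by
  intro p hp hpn K _ _ T g hB hD hE hT
  obtain ⟨hPT, ⟨m, a, b, H, K', hF, ha, habs⟩, h3⟩ := hT
  obtain ⟨N, rfl⟩ : ∃ N, a = N + 1 := ⟨a - 1, by omega⟩
  exact (hP T hPT).2.2.2
    (hF.regularSurfaceHugging_of_absContact T g hB hD habs (ringKrullDim_eq_three_of_threefoldTower h3 m))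

/-- **DECIDED MOD 31571 (every class `P`): THE LATENT-FACTOR CUT IS EMPTY given `ContactHuggingTowersTerminate n`.**
[folklore] -/
theorem noTowerWild_latentFactor_of_contact {n : ℕ} (h71 : ContactHuggingTowersTerminate n) (P : ForcedTower → Prop) :
    NoTowerWild n fun T => P T ∧ LatentFactorTower T := by
  intro p hp hpn K _ _ T g hB hD hE hT
  obtain ⟨-, m, a, b, H, K', hF, ha, habs⟩ := hT
  obtain ⟨N, rfl⟩ : ∃ N, a = N + 1 := ⟨a - 1, by omega⟩
  exact h71 p hp K T g hB hD hE (hF.contactHugging_of_absContact T g hB hD habs)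

/-- **CELL A IS EMPTY (KERNEL, every `n`).** [folklore] -/
theorem wildLatentFactorThreefoldMixed_holds (n : ℕ) :
    WildLatentFactorThreefoldMixedWallFreeFreshJumpShallowCompanionKangarooTowersTerminate n :=
  noTowerWild_latentFactor_threefold _ fun _ h => h.singularClass

/-- **CELL B IS EMPTY MOD 31571 at weight `n`.** [folklore] -/
theorem wildLatentFactorNonThreefoldMixed_of_contact {n : ℕ} (h71 : ContactHuggingTowersTerminate n) :
    WildLatentFactorNonThreefoldMixedWallFreeFreshJumpShallowCompanionKangarooTowersTerminate n :=
  noTowerWild_latentFactor_of_contact h71 _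

/-- **EXACT (pure logic): the mixed residual = CELL A ∧ CELL B ∧ CELL C ∧ CELL D.** [folklore] -/
theorem wildMixedWallFreeFreshJumpShallow_split_cells (n : ℕ) :
    WildMixedWallFreeFreshJumpShallowCompanionKangarooTowersTerminate n ↔
      WildLatentFactorThreefoldMixedWallFreeFreshJumpShallowCompanionKangarooTowersTerminate n ∧
        (WildLatentFactorNonThreefoldMixedWallFreeFreshJumpShallowCompanionKangarooTowersTerminate n ∧
          (WildOccultDivisorialMixedWallFreeFreshJumpShallowCompanionKangarooTowersTerminate n ∧
            WildOccultNonDivisorialMixedWallFreeFreshJumpShallowCompanionKangarooTowersTerminate n)) :=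
  (noTowerWild_split (fun T => MixedResidual n T) fun T => LatentFactorTower T ∧ ThreefoldTower T).trans
    (Iff.and Iff.rfl ((noTowerWild_split _ LatentFactorTower).trans (Iff.and Iff.rfl (noTowerWild_split _ DivisorialTower))))

/-- **EXACT RE-LOCATION, HYPOTHESIS-FREE (every `n`): the mixed residual ⟺ CELL B ∧ CELL C ∧ CELL D.** [folklore] -/
theorem wildMixedWallFreeFreshJumpShallow_iff_g33 (n : ℕ) :
    WildMixedWallFreeFreshJumpShallowCompanionKangarooTowersTerminate n ↔
      WildLatentFactorNonThreefoldMixedWallFreeFreshJumpShallowCompanionKangarooTowersTerminate n ∧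
        (WildOccultDivisorialMixedWallFreeFreshJumpShallowCompanionKangarooTowersTerminate n ∧
          WildOccultNonDivisorialMixedWallFreeFreshJumpShallowCompanionKangarooTowersTerminate n) :=
  (wildMixedWallFreeFreshJumpShallow_split_cells n).trans
    ⟨fun h => h.2, fun h => ⟨wildLatentFactorThreefoldMixed_holds n, h⟩⟩

/-- **EXACT RE-LOCATION MOD 31571 at weight `n`: the mixed residual ⟺ THE OCCULT CELLS C ∧ D.** [folklore] -/
theorem wildMixedWallFreeFreshJumpShallow_iff_g33_of_contact {n : ℕ} (h71 : ContactHuggingTowersTerminate n) :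
    WildMixedWallFreeFreshJumpShallowCompanionKangarooTowersTerminate n ↔
      WildOccultDivisorialMixedWallFreeFreshJumpShallowCompanionKangarooTowersTerminate n ∧
        WildOccultNonDivisorialMixedWallFreeFreshJumpShallowCompanionKangarooTowersTerminate n :=
  (wildMixedWallFreeFreshJumpShallow_iff_g33 n).trans
    ⟨fun h => h.2, fun h => ⟨wildLatentFactorNonThreefoldMixed_of_contact h71, h⟩⟩

/-- **THE LETTERS OF THE OCCULT CELLS ARE SHARP** (kernel + pure logic): in an occult tower (`¬ LatentFactorTower`)
NO factor of positive
weight of ANY stalk factorization at ANY stage carries absolute contact of its own weight — neither factor —, there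
is NO factor of
weight `1`, and a divisorial tower has a principal factor of weight `≥ 2`. [folklore] -/
theorem occult_letters {T : ForcedTower} (hocc : ¬ LatentFactorTower T) :
    (∀ (m a b : ℕ) (H K : (T.St m).IdealSheafData), FactorAt T m a b H K → 1 ≤ a → ¬ IsAbsContactAt H a (T.pt m)) ∧
      (∀ (m a b : ℕ) (H K : (T.St m).IdealSheafData), FactorAt T m a b H K → 1 ≤ b → ¬ IsAbsContactAt K b (T.pt m)) ∧
      (∀ (m a b : ℕ) (H K : (T.St m).IdealSheafData), FactorAt T m a b H K → a ≠ 1) ∧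
      (DivisorialTower T →
        ∃ (m a b : ℕ) (H K : (T.St m).IdealSheafData), FactorAt T m a b H K ∧ 2 ≤ a ∧ (stalkIdeal H (T.pt m)).IsPrincipal) := by
  refine ⟨fun m a b H K hF ha habs => hocc ⟨m, a, b, H, K, hF, ha, habs⟩,
    fun m a b H K hF hb habs => hocc ⟨m, b, a, K, H, hF.symm, hb, habs⟩, fun m a b H K hF ha => ?_, ?_⟩
  · subst ha
    exact hocc ⟨m, 1, b, H, K, hF, le_rfl, hF.isAbsContactAt_one⟩
  · rintro ⟨m, a, b, H, K, hF, ha, hP⟩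
    refine ⟨m, a, b, H, K, hF, ?_, hP⟩
    by_contra hlt
    have h1 : a = 1 := by omega
    subst h1
    exact hocc ⟨m, 1, b, H, K, hF, le_rfl, hF.isAbsContactAt_one⟩

/-- **THE OCCULT WEIGHTS ARE MULTIPLES OF `p`** (kernel): in an occult tower over a field of characteristic `p`, at
a marked point with
separable residue field (every marked point over a perfect field) BOTH weights of every stalk factorization with
positive weights are
divisible by `p` — so a properly factoring occult tower has `n ≥ 2p`. (Sources: Giraud1975; EncinasVillamayor2000, Thm. 4.9.) -/
theorem FactorAt.dvd_of_occult {p : ℕ} (hp : p.Prime) [CharP k p] (T : ForcedTower) (g : T.St 0 ⟶ Spec (.of k))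
    (hB : IsBase (T.St 0) g) {m a b : ℕ} {H K : (T.St m).IdealSheafData} (hF : FactorAt T m a b H K)
    (hsep : SepResidueAt (toRoot T m ≫ g) (T.pt m)) (hocc : ¬ LatentFactorTower T) (ha : 1 ≤ a) (hb : 1 ≤ b) :
    p ∣ a ∧ p ∣ b :=
  ⟨Classical.by_contradiction fun hpa => hocc ⟨m, a, b, H, K, hF, ha, hF.isAbsContactAt_of_tame hp T g hB hpa hsep⟩,
    Classical.by_contradiction fun hpb =>
      hocc ⟨m, b, a, K, H, hF.symm, hb, hF.symm.isAbsContactAt_of_tame hp T g hB hpb hsep⟩⟩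

/-- BY NAME: **no wild LATENT-FACTOR-THREEFOLD mixed tower** (CELL A; DECIDED in kernel). -/
def NoWildLatentFactorThreefoldMixedTowers : Prop :=
  ∀ n : ℕ, 1 ≤ n → WildLatentFactorThreefoldMixedWallFreeFreshJumpShallowCompanionKangarooTowersTerminate n

/-- BY NAME: **no wild LATENT-FACTOR non-threefold mixed tower** (CELL B; DECIDED mod 31571). -/
def NoWildLatentFactorNonThreefoldMixedTowers : Prop :=
  ∀ n : ℕ, 1 ≤ n → WildLatentFactorNonThreefoldMixedWallFreeFreshJumpShallowCompanionKangarooTowersTerminate n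

/-- BY NAME: **no wild OCCULT DIVISORIAL mixed tower** — THE LOCATED RESIDUAL of the aside chain
`NoWildContactFreeOffLocusTowers ⊇ … ⊇ NoWildMixedWallFreeFreshJumpShallowCompanionKangarooTowers ⊇ ·` after g33 (CELL C). -/
def NoWildOccultDivisorialMixedTowers : Prop :=
  ∀ n : ℕ, 1 ≤ n → WildOccultDivisorialMixedWallFreeFreshJumpShallowCompanionKangarooTowersTerminate n

/-- BY NAME: **no wild OCCULT NON-DIVISORIAL mixed tower** (CELL D; UNDECIDED · ATTACKABLE by Law C after restriction). -/
def NoWildOccultNonDivisorialMixedTowers : Prop :=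
  ∀ n : ℕ, 1 ≤ n → WildOccultNonDivisorialMixedWallFreeFreshJumpShallowCompanionKangarooTowersTerminate n

/-- **THE g33 LOCATED RESIDUAL OF THE LENS-4 COLUMN AS ONE NAME** — no wild OCCULT mixed forced tower: cell C
(occult ∧ DIVISORIAL,
`NoWildOccultDivisorialMixedTowers` — inhabited by the profile (O1) = `(y² + x³(x+u)²)·(y², u³, yu²)` over `𝔽₂`, `n
= 4`; UNDECIDED · IDEA-NEEDED)
∧ cell D (occult ∧ NON-DIVISORIAL, `NoWildOccultNonDivisorialMixedTowers` — UNDECIDED · ATTACKABLE by Law C after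
restriction).  Every stalk
factor of such a tower at every stage is absolutely contact-free at its own weight (§100–§103).  Re-locations BY
NAME: the hypothesis-free
`noWildMixedWallFreeFreshJumpShallowCompanionKangarooTowers_iff_g33` (g32 residual ⟺ cell B ∧ C ∧ D, cell B decided
modulo 31571 by
`noWildLatentFactorNonThreefoldMixedTowers_of_h71`) and, in the Theses cone (`MaxContactCutFactorCut`),
`noWildContactFreeOffLocusTowers_iff_g33
(h71) (h640)` (tree aside 28338 ⟺ C ∧ D).  [WRITER-ADDED declaration (decomp-res writer g12) per the critic rider
INBOX :1051 (CRITIC-LEDGER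
row 191): «append this 3-line def + docstring to FactorCutCells.lean if absent» — the only declaration of the node's
tree files that is not
verbatim lens text; it is the HOME of the route aside that supersedes item 28078.] -/
def NoWildOccultMixedTowers : Prop :=
  NoWildOccultDivisorialMixedTowers ∧ NoWildOccultNonDivisorialMixedTowers

/-- **CELL A DECIDED BY NAME (kernel).** [folklore] -/
theorem noWildLatentFactorThreefoldMixedTowers_holds : NoWildLatentFactorThreefoldMixedTowers := fun n _ =>
  wildLatentFactorThreefoldMixed_holds n

/-- **EXACT BY NAME as a conjunction of the four cells, HYPOTHESIS-FREE.** [folklore] -/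
theorem noWildMixedWallFreeFreshJumpShallowCompanionKangarooTowers_iff_cells :
    NoWildMixedWallFreeFreshJumpShallowCompanionKangarooTowers ↔
      NoWildLatentFactorThreefoldMixedTowers ∧ NoWildLatentFactorNonThreefoldMixedTowers ∧ NoWildOccultDivisorialMixedTowers ∧
        NoWildOccultNonDivisorialMixedTowers :=
  ⟨fun h => ⟨fun n hn => ((wildMixedWallFreeFreshJumpShallow_split_cells n).mp (h n hn)).1,
      fun n hn => ((wildMixedWallFreeFreshJumpShallow_split_cells n).mp (h n hn)).2.1,
      fun n hn => ((wildMixedWallFreeFreshJumpShallow_split_cells n).mp (h n hn)).2.2.1,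
      fun n hn => ((wildMixedWallFreeFreshJumpShallow_split_cells n).mp (h n hn)).2.2.2⟩,
    fun h n hn => (wildMixedWallFreeFreshJumpShallow_split_cells n).mpr ⟨h.1 n hn, h.2.1 n hn, h.2.2.1 n hn, h.2.2.2 n hn⟩⟩

/-- **EXACT RE-LOCATION BY NAME, HYPOTHESIS-FREE: the g32 residual ⟺ CELL B ∧ CELL C ∧ CELL D.** [folklore] -/
theorem noWildMixedWallFreeFreshJumpShallowCompanionKangarooTowers_iff_g33 :
    NoWildMixedWallFreeFreshJumpShallowCompanionKangarooTowers ↔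
      NoWildLatentFactorNonThreefoldMixedTowers ∧ NoWildOccultDivisorialMixedTowers ∧ NoWildOccultNonDivisorialMixedTowers :=
  noWildMixedWallFreeFreshJumpShallowCompanionKangarooTowers_iff_cells.trans
    ⟨fun h => h.2, fun h => ⟨noWildLatentFactorThreefoldMixedTowers_holds, h⟩⟩

/-- up-link (hypothesis-free): the occult divisorial cell ⟸ the g32 residual. [folklore] -/
theorem noWildOccultDivisorialMixedTowers_of_g32 (h : NoWildMixedWallFreeFreshJumpShallowCompanionKangarooTowers) :
    NoWildOccultDivisorialMixedTowers :=
  (noWildMixedWallFreeFreshJumpShallowCompanionKangarooTowers_iff_g33.mp h).2.1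

/-- up-link (hypothesis-free): the occult non-divisorial cell ⟸ the g32 residual. [folklore] -/
theorem noWildOccultNonDivisorialMixedTowers_of_g32 (h : NoWildMixedWallFreeFreshJumpShallowCompanionKangarooTowers) :
    NoWildOccultNonDivisorialMixedTowers :=
  (noWildMixedWallFreeFreshJumpShallowCompanionKangarooTowers_iff_g33.mp h).2.2

/-- up-link from the TREE aside `NoWildContactFreeOffLocusTowers` (hypothesis-free). [folklore] -/
theorem noWildOccultMixedTowers_of_aside (h : NoWildContactFreeOffLocusTowers) :
    NoWildOccultDivisorialMixedTowers ∧ NoWildOccultNonDivisorialMixedTowers :=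
  ⟨noWildOccultDivisorialMixedTowers_of_g32 (noWildMixedWallFreeFreshJumpShallowCompanionKangarooTowers_of_aside h),
    noWildOccultNonDivisorialMixedTowers_of_g32 (noWildMixedWallFreeFreshJumpShallowCompanionKangarooTowers_of_aside h)⟩

/-- **THE LATENT-FACTOR CUTS OF THE WHOLE TREE ASIDE** (class-generic; the cut does not depend on the intermediate
nodes): inside the
singular class the latent-factor-threefold part is EMPTY IN KERNEL, and the latent-factor part is EMPTY MOD 31571. [folklore] -/
theorem noTowerWild_contactFreeOffLocus_latentFactor {n : ℕ} (h71 : ContactHuggingTowersTerminate n) (P : ForcedTower → Prop)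
    (hP : ∀ T, P T → SingularClass T) :
    (NoTowerWild n fun T => P T ∧ (LatentFactorTower T ∧ ThreefoldTower T)) ∧ NoTowerWild n fun T => P T ∧ LatentFactorTower T :=
  ⟨noTowerWild_latentFactor_threefold P hP, noTowerWild_latentFactor_of_contact h71 P⟩

end FactorCells

end Summit.ResolutionOfSingularities.ResolutionOfSingularities.Theorems.HugValuationCut
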